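import Summits.QuantumFields.YangMills.Theorems.BalabanUVNodesSpineReadingOfRecord13CoPHKComponentSizeBlocksSeqIndex
import Literature.MathematicalPhysics.QuantumFieldTheory.Balaban1983to89.Node00.TwoRunSiteFreshCubes

/-!
# THE N20 LETTER MOVED TO WHERE PRINT PAYS: on the sequence index of record the INSIDE event «the level-`lv j` block of `b` lies in `Z_j`» is the finite union of the FRESH-BLOCK events
# below it (NODE 00 `iterBlock_subset_Λ_compl_iff_exists_fresh`), so gen 34's one-block conditional letter follows, by a union bound, from FRESH-BLOCK CONDITIONAL letters — one per
# level `i ≤ j` and finer block `c ⊆` the block of `b`, «`c ⊆ Z_i`, `c ⊆ Λ_{i−1}`» — with the INHERITANCE VOLUME `Σ_{i ≤ j} (L^4)^{lv j − lv i} · ζ K j i ≤ η K j` DISPLAYED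

Cell `pub-ymgap`, YM-PLAN Track A (HUMAN RULING D-0062; width push D-0149); seat `pub-ymgap-dag-n20-d` (R134 (a) N20 NE7b s3 = the U5d ∕ `crOfRecord₁₃` lineage, its declarer)
gen 35; companion of `…CoPHKComponentSizeBlocksSeqIndex` (gen 34: ★★★ `relWeightBound_card_of_condInsideSeqLetters_id_supNear`, hypotheses `hCA ∕ hCB`) and of
`Node00/TwoRunSiteFreshCubes` (gen 35: `exists_fresh_of_iterBlock_subset_Λ_compl`, `iterBlock_subset_Λ_compl_of_subset_of_le`, `card_filter_iterBlock_subset`).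
`--kind proof --supports stmt-QuantumFields-27366 --as helper` (K3⁸); COUNT-NEUTRAL; THEOREMS ONLY (0 `def`).  [III] = [Balaban1988Convergent]; [LF-II] = [Balaban1989LargeFieldII].
WHY.  The (2.1) index of record ([III] p. 254: `Ω₁ ⊇ Λ₁ ⊇ Ω₂ ⊇ Λ₂ ⊇ …`, `Ω_j, Λ_j ∈ 𝐃_j`) makes the large-field regions `Z_j = Λ_jᶜ` GROW and re-coarsen: one finer large-field block
anywhere inside a coarse block puts the whole coarse block into `Z_j` for every later `j` (INHERITANCE).  Gen 34's letter asks for the relative weight of «`b`'s block ⊆ `Z_j`» given an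
environment — an event that mixes the FRESH cause (print's NEW large-field region, the only place [LF-II] (1.79) p. 383 ∕ (1.85) p. 386 put a small factor) with everything inherited
from below.  §2 makes the inheritance a KERNEL INEQUALITY between weight sums (★ `sum_insideFine_le_sum_inside_A ∕ _B`: at the identity dial, for every finer block `c` inside `b`'s block
and every `i ≤ j`, the classes with «`c ⊆ Z_i`» and the environment weigh at most those with «`b`'s block `⊆ Z_j`» and the environment — so ANY inhabitant `η K j` of gen 34's letter
bounds `(L^4)^{lv j − lv i}·j` finer inside-letters with the same constant: gen 34's caveat (ii) «volume count» in kernel form), and §3 moves the letter to the fresh events: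
★★ `sum_insideInsert_le_sum_fresh_A ∕ _B` (numerator of `hCA ∕ hCB` ≤ `Σ_{i ≤ j} Σ_{c ⊆ b̂} Σ_{fresh(i,c) ∧ env}`) and ★★★ `relWeightBound_card_of_freshCondSeqLetters_id_supNear` — the N20
face at the record's carriers from FRESH-BLOCK CONDITIONAL LETTERS with the inheritance volume `Σ_{i ∈ [1,j]} (L^4)^{lv K j − lv K i} · ζ K j i ≤ η K j` an explicit hypothesis next
to gen 34's polynomial numerics `2·((2ϱ+1)^4·81·(2ϱ+1)^4)²·η K j ≤ 1`.
HONEST FRAMING.  [folklore] finite-sum bookkeeping BY NAME; the fresh-block letters are HYPOTHESES (inhabited for no family today; NOT PRINTED as statements about the (2.18) class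
weights; LCS-shaped — a conditional bound for ONE fresh large-field block given a far environment; inhabitable only under a history-rewriting residual selector, (ρ1)∕(ρ2) of
`…SpineReadingOfRecord13CoPH`, which is exactly what the displayed volume sum prices: levels a sequence of record no longer records contribute empty events); NO weight is
bounded, NO estimate proved; nothing of Bałaban's asserted; NE7 ∕ NE7b ∕ NE7c NOT PRINTED for `d = 4` ∕ NOT proved; no `Provisos₁₃CoPH` inhabitant claimed (K0⁷ OPEN); K3⁸ v7
untouched; N19 ∕ N20 ∕ N21 ∕ N27 NOT discharged; counts UNMOVED (typed 28∕28 · discharged 8∕27); one finite four-torus programme at fixed `ε` — NOT ℝ⁴, NOT OS, NOT a mass gap, NOT the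
Clay problem.  No `def`, no `instance`, no `notation`, no `sorry`; no decl below carries a cite tag.
-/

noncomputable section

open scoped BigOperators
open Finset

namespace YMDAG.UVSplit

open Literature.MathematicalPhysics.QuantumFieldTheory.Balaban1983to89
open Literature.MathematicalPhysics.QuantumFieldTheory.Balaban1983to89.T4Continuum
open Literature.MathematicalPhysics.QuantumFieldTheory.Balaban1983to89.Node00
open Literature.MathematicalPhysics.QuantumFieldTheory.Balaban1983to89.B5Eq118OneStroke (iterBlockOf iterBlock)
open T4WeightBudget (RelWeightBound)
open Summit.QuantumFields.YangMills.BalabanUVNodes.N21KeyedShellWeightShellZero (wOfRecord₉_nonneg_of_provisos₁₃CoPH)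
open Summit.QuantumFields.YangMills.Theorems.N21ShellSplitOfRecord13CoPH (classWeightOfDatum₉_nonneg')

variable {F : T4Family} {N : ℕ} [NeZero N]

/-! ## §1 [folklore] A union bound for non-negative weights -/

/-- [folklore] **UNION BOUND**: if every `s` with `E s` satisfies `G i s` for some index `i` of the finite family `I`, then for non-negative weights
`Σ_{s : E s} w s ≤ Σ_{i ∈ I} Σ_{s : G i s} w s`. [bookkeeping] -/
theorem sum_filter_le_sum_sum_filter_of_cover {σ ι : Type*} [Fintype σ] (I : Finset ι) (w : σ → ℝ) (hw : ∀ s, 0 ≤ w s) (E : σ → Prop) (G : ι → σ → Prop)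
    [DecidablePred E] [∀ i, DecidablePred (G i)] (hcover : ∀ s, E s → ∃ i ∈ I, G i s) :
    ∑ s ∈ Finset.univ.filter E, w s ≤ ∑ i ∈ I, ∑ s ∈ Finset.univ.filter (G i), w s := by
  calc ∑ s ∈ Finset.univ.filter E, w s = ∑ s, if E s then w s else 0 := Finset.sum_filter _ _
    _ ≤ ∑ s, ∑ i ∈ I, if G i s then w s else 0 := by
        refine Finset.sum_le_sum fun s _ => ?_
        by_cases hE : E s
        · obtain ⟨i, hi, hG⟩ := hcover s hE
          rw [if_pos hE]
          calc w s = if G i s then w s else 0 := by rw [if_pos hG]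
            _ ≤ ∑ i ∈ I, if G i s then w s else 0 :=
                Finset.single_le_sum (f := fun i => if G i s then w s else 0) (fun i _ => by
                  by_cases h : G i s
                  · rw [if_pos h]; exact hw s
                  · rw [if_neg h]) hi
        · rw [if_neg hE]
          exact Finset.sum_nonneg fun i _ => by
            by_cases h : G i s
            · rw [if_pos h]; exact hw s
            · rw [if_neg h]
    _ = ∑ i ∈ I, ∑ s, if G i s then w s else 0 := Finset.sum_comm
    _ = ∑ i ∈ I, ∑ s ∈ Finset.univ.filter (G i), w s := Finset.sum_congr rfl fun i _ => (Finset.sum_filter _ _).symm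

/-! ## §2 Inheritance in weights: every finer inside event weighs at most the coarse one (identity dial, sequence index) -/

section Inherit

variable (θ : Stage13HParams F N) (hP : θ.Provisos₁₃CoPH F N) (K₀ : ℕ) (g₀ : ℕ → ℝ) (os : List (ULoop F)) (lv : ℕ → ℕ → ℕ)

open scoped Classical in
/-- ★ **RUN A — INHERITANCE IN WEIGHTS**: for `1 ≤ i ≤ j ≤ K₀ + K`, block levels `lv K i ≤ lv K j ≤ j` in the standing range, a level-`lv K i` block `c` inside the level-`lv K j` block of
`b`, and ANY side event `E` (e.g. an environment «the blocks of `S` lie in `Z_j`»): the (2.18) class weights of run A's sequences of record with «`c ⊆ Z_i(s)` and `E s`» sum to at most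
those with «`b`'s block `⊆ Z_j(s)` and `E s`» (the former event is contained in the latter, NODE 00 `iterBlock_subset_Λ_compl_of_subset_of_le`; weights `≥ 0`).  Consequently an
inhabitant `η K j` of gen 34's one-block conditional letter at `(j, b)` bounds every such finer inside-letter with the same constant. [bookkeeping] -/
theorem sum_insideFine_le_sum_inside_A (K : ℕ) (t : ℝ) {i j : ℕ} (hi : 1 ≤ i) (hij : i ≤ j) (hjK : j ≤ K₀ + K) (hlvi : lv K i ≤ F.m + (K₀ + K))
    (hlvj : lv K j ≤ F.m + (K₀ + K)) (hlvjj : lv K j ≤ j) {c : Site (F.P (K₀ + K)) (lv K i)} {b : Site (F.P (K₀ + K)) (lv K j)}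
    (hcb : (↑(iterBlock (lv K i) c) : Set (Site (F.P (K₀ + K)) 0)) ⊆ ↑(iterBlock (lv K j) b))
    (E : SeqOfRecord F θ.ν θ.τ9.M (histA₁₃ θ K₀ g₀ K) (K₀ + K) (K₀ + K) → Prop) :
    ∑ s ∈ Finset.univ.filter (fun s : SeqOfRecord F θ.ν θ.τ9.M (histA₁₃ θ K₀ g₀ K) (K₀ + K) (K₀ + K) =>
        (↑(iterBlock (lv K i) c) : Set (Site (F.P (K₀ + K)) 0)) ⊆ (s.Λ i)ᶜ ∧ E s),
      classWeightOfDatum₉ F N θ.toStage9Params (datumOfRecord₁₃CoPH F N θ hP) g₀ os (runA₁₃ F K₀ g₀ K) (histA₁₃ θ K₀ g₀ K) (K₀ + K) t s ≤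
    ∑ s ∈ Finset.univ.filter (fun s : SeqOfRecord F θ.ν θ.τ9.M (histA₁₃ θ K₀ g₀ K) (K₀ + K) (K₀ + K) =>
        (↑(iterBlock (lv K j) b) : Set (Site (F.P (K₀ + K)) 0)) ⊆ (s.Λ j)ᶜ ∧ E s),
      classWeightOfDatum₉ F N θ.toStage9Params (datumOfRecord₁₃CoPH F N θ hP) g₀ os (runA₁₃ F K₀ g₀ K) (histA₁₃ θ K₀ g₀ K) (K₀ + K) t s := by
  refine Finset.sum_le_sum_of_subset_of_nonneg (fun s hs => ?_) (fun s _ _ => ?_)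
  · rw [Finset.mem_filter] at hs ⊢
    exact ⟨hs.1, iterBlock_subset_Λ_compl_of_subset_of_le F θ.ν θ.τ9.M (histA₁₃ θ K₀ g₀ K) (K₀ + K) (K₀ + K) s hi hij hjK hlvi hlvj hlvjj hcb hs.2.1, hs.2.2⟩
  · exact classWeightOfDatum₉_nonneg' F N θ.toStage9Params (datumOfRecord₁₃CoPH F N θ hP) g₀ os (runA₁₃ F K₀ g₀ K) (histA₁₃ θ K₀ g₀ K) (K₀ + K)
      (wOfRecord₉_nonneg_of_provisos₁₃CoPH F θ hP (runA₁₃ F K₀ g₀ K) (histA₁₃ θ K₀ g₀ K)) t s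

open scoped Classical in
/-- ★ **RUN B — INHERITANCE IN WEIGHTS** (`0 < M`): the same over run B's sequences `s′` (cutoff `K₀ + K + 1`) with the regions `((truncShift … s′).Λ ·)ᶜ` of its key of record
(node U5d's flow-free truncation, an admissible sequence of length `K₀ + K` on run A's torus). [bookkeeping] -/
theorem sum_insideFine_le_sum_inside_B (hM : 0 < θ.τ9.M) (K : ℕ) (t : ℝ) {i j : ℕ} (hi : 1 ≤ i) (hij : i ≤ j) (hjK : j ≤ K₀ + K) (hlvi : lv K i ≤ F.m + (K₀ + K))
    (hlvj : lv K j ≤ F.m + (K₀ + K)) (hlvjj : lv K j ≤ j) {c : Site (F.P (K₀ + K)) (lv K i)} {b : Site (F.P (K₀ + K)) (lv K j)}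
    (hcb : (↑(iterBlock (lv K i) c) : Set (Site (F.P (K₀ + K)) 0)) ⊆ ↑(iterBlock (lv K j) b))
    (E : SeqOfRecord F θ.ν θ.τ9.M (histB₁₃ θ K₀ g₀ K) (K₀ + K + 1) (K₀ + K + 1) → Prop) :
    ∑ s' ∈ Finset.univ.filter (fun s' : SeqOfRecord F θ.ν θ.τ9.M (histB₁₃ θ K₀ g₀ K) (K₀ + K + 1) (K₀ + K + 1) =>
        (↑(iterBlock (lv K i) c) : Set (Site (F.P (K₀ + K)) 0)) ⊆ ((truncShift F θ.ν hM (histB₁₃ θ K₀ g₀ K) s').Λ i)ᶜ ∧ E s'),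
      classWeightOfDatum₉ F N θ.toStage9Params (datumOfRecord₁₃CoPH F N θ hP) g₀ os (runB₁₃ F K₀ g₀ K) (histB₁₃ θ K₀ g₀ K) (K₀ + K + 1) t s' ≤
    ∑ s' ∈ Finset.univ.filter (fun s' : SeqOfRecord F θ.ν θ.τ9.M (histB₁₃ θ K₀ g₀ K) (K₀ + K + 1) (K₀ + K + 1) =>
        (↑(iterBlock (lv K j) b) : Set (Site (F.P (K₀ + K)) 0)) ⊆ ((truncShift F θ.ν hM (histB₁₃ θ K₀ g₀ K) s').Λ j)ᶜ ∧ E s'),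
      classWeightOfDatum₉ F N θ.toStage9Params (datumOfRecord₁₃CoPH F N θ hP) g₀ os (runB₁₃ F K₀ g₀ K) (histB₁₃ θ K₀ g₀ K) (K₀ + K + 1) t s' := by
  refine Finset.sum_le_sum_of_subset_of_nonneg (fun s' hs => ?_) (fun s' _ _ => ?_)
  · rw [Finset.mem_filter] at hs ⊢
    exact ⟨hs.1, iterBlock_subset_Λ_compl_of_subset_of_le F θ.ν θ.τ9.M (fun j => histB₁₃ θ K₀ g₀ K (j + 1)) (K₀ + K) (K₀ + K)
      (truncShift F θ.ν hM (histB₁₃ θ K₀ g₀ K) s') hi hij hjK hlvi hlvj hlvjj hcb hs.2.1, hs.2.2⟩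
  · exact classWeightOfDatum₉_nonneg' F N θ.toStage9Params (datumOfRecord₁₃CoPH F N θ hP) g₀ os (runB₁₃ F K₀ g₀ K) (histB₁₃ θ K₀ g₀ K) (K₀ + K + 1)
      (wOfRecord₉_nonneg_of_provisos₁₃CoPH F θ hP (runB₁₃ F K₀ g₀ K) (histB₁₃ θ K₀ g₀ K)) t s'

end Inherit

/-! ## §3 The numerator of the one-block letter is covered by the fresh-block events; the face from fresh-block conditional letters -/

section Fresh

variable (θ : Stage13HParams F N) (hP : θ.Provisos₁₃CoPH F N) (K₀ : ℕ) (g₀ : ℕ → ℝ) (os : List (ULoop F)) (lv : ℕ → ℕ → ℕ)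

open scoped Classical in
/-- ★★ **RUN A — THE NUMERATOR OF THE ONE-BLOCK LETTER IS COVERED BY THE FRESH-BLOCK EVENTS**: for `1 ≤ j`, block levels `lv K` monotone on `[1, j]` with `lv K i ≤ i`
and in the standing range, any environment `S` and block `b`: the (2.18) class weights of run A's sequences whose `Z_j` contains the blocks of `insert b S` sum to at most
`Σ_{i ∈ [1,j]} Σ_{c ⊆ b̂} Σ_{s : c ⊆ Z_i(s), c ⊆ Λ_{i−1}(s) (i ≥ 2), blocks of S ⊆ Z_j(s)} w(s)` (`c` over the level-`lv K i` blocks inside `b`'s block `b̂`; NODE 00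
`exists_fresh_of_iterBlock_subset_Λ_compl` + §1). [bookkeeping] -/
theorem sum_insideInsert_le_sum_fresh_A (K : ℕ) (t : ℝ) {j : ℕ} (h1 : 1 ≤ j)
    (hmono : ∀ i i', 1 ≤ i → i ≤ i' → i' ≤ j → lv K i ≤ lv K i') (hlv : ∀ i, lv K i ≤ F.m + (K₀ + K)) (hlvle : ∀ i, 1 ≤ i → i ≤ j → lv K i ≤ i)
    (S : Finset (Site (F.P (K₀ + K)) (lv K j))) (b : Site (F.P (K₀ + K)) (lv K j)) :
    ∑ s ∈ Finset.univ.filter (fun s : SeqOfRecord F θ.ν θ.τ9.M (histA₁₃ θ K₀ g₀ K) (K₀ + K) (K₀ + K) =>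
        ∀ b' ∈ insert b S, (↑(iterBlock (lv K j) b') : Set (Site (F.P (K₀ + K)) 0)) ⊆ (s.Λ j)ᶜ),
      classWeightOfDatum₉ F N θ.toStage9Params (datumOfRecord₁₃CoPH F N θ hP) g₀ os (runA₁₃ F K₀ g₀ K) (histA₁₃ θ K₀ g₀ K) (K₀ + K) t s ≤
    ∑ i ∈ Finset.Icc 1 j, ∑ c ∈ Finset.univ.filter (fun c : Site (F.P (K₀ + K)) (lv K i) =>
        (↑(iterBlock (lv K i) c) : Set (Site (F.P (K₀ + K)) 0)) ⊆ ↑(iterBlock (lv K j) b)),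
      ∑ s ∈ Finset.univ.filter (fun s : SeqOfRecord F θ.ν θ.τ9.M (histA₁₃ θ K₀ g₀ K) (K₀ + K) (K₀ + K) =>
          ((↑(iterBlock (lv K i) c) : Set (Site (F.P (K₀ + K)) 0)) ⊆ (s.Λ i)ᶜ ∧
            (2 ≤ i → (↑(iterBlock (lv K i) c) : Set (Site (F.P (K₀ + K)) 0)) ⊆ s.Λ (i - 1))) ∧
          ∀ b' ∈ S, (↑(iterBlock (lv K j) b') : Set (Site (F.P (K₀ + K)) 0)) ⊆ (s.Λ j)ᶜ),
        classWeightOfDatum₉ F N θ.toStage9Params (datumOfRecord₁₃CoPH F N θ hP) g₀ os (runA₁₃ F K₀ g₀ K) (histA₁₃ θ K₀ g₀ K) (K₀ + K) t s := by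
  -- the index family: pairs `⟨i, c⟩`, `i ∈ [1, j]`, `c` a level-`lv K i` block inside `b`'s block
  have hw : ∀ s : SeqOfRecord F θ.ν θ.τ9.M (histA₁₃ θ K₀ g₀ K) (K₀ + K) (K₀ + K),
      0 ≤ classWeightOfDatum₉ F N θ.toStage9Params (datumOfRecord₁₃CoPH F N θ hP) g₀ os (runA₁₃ F K₀ g₀ K) (histA₁₃ θ K₀ g₀ K) (K₀ + K) t s :=
    fun s => classWeightOfDatum₉_nonneg' F N θ.toStage9Params (datumOfRecord₁₃CoPH F N θ hP) g₀ os (runA₁₃ F K₀ g₀ K) (histA₁₃ θ K₀ g₀ K) (K₀ + K)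
      (wOfRecord₉_nonneg_of_provisos₁₃CoPH F θ hP (runA₁₃ F K₀ g₀ K) (histA₁₃ θ K₀ g₀ K)) t s
  have h := sum_filter_le_sum_sum_filter_of_cover
    ((Finset.Icc 1 j).sigma fun i => Finset.univ.filter (fun c : Site (F.P (K₀ + K)) (lv K i) =>
      (↑(iterBlock (lv K i) c) : Set (Site (F.P (K₀ + K)) 0)) ⊆ ↑(iterBlock (lv K j) b)))
    (fun s => classWeightOfDatum₉ F N θ.toStage9Params (datumOfRecord₁₃CoPH F N θ hP) g₀ os (runA₁₃ F K₀ g₀ K) (histA₁₃ θ K₀ g₀ K) (K₀ + K) t s) hw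
    (fun s : SeqOfRecord F θ.ν θ.τ9.M (histA₁₃ θ K₀ g₀ K) (K₀ + K) (K₀ + K) =>
      ∀ b' ∈ insert b S, (↑(iterBlock (lv K j) b') : Set (Site (F.P (K₀ + K)) 0)) ⊆ (s.Λ j)ᶜ)
    (fun p s => ((↑(iterBlock (lv K p.1) p.2) : Set (Site (F.P (K₀ + K)) 0)) ⊆ (s.Λ p.1)ᶜ ∧
        (2 ≤ p.1 → (↑(iterBlock (lv K p.1) p.2) : Set (Site (F.P (K₀ + K)) 0)) ⊆ s.Λ (p.1 - 1))) ∧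
      ∀ b' ∈ S, (↑(iterBlock (lv K j) b') : Set (Site (F.P (K₀ + K)) 0)) ⊆ (s.Λ j)ᶜ) ?_
  · rw [Finset.sum_sigma] at h
    exact h
  · intro s hs
    have hb : (↑(iterBlock (lv K j) b) : Set (Site (F.P (K₀ + K)) 0)) ⊆ (s.Λ j)ᶜ := hs b (Finset.mem_insert_self b S)
    obtain ⟨i, hi, c, hcb, hcZ, hfresh⟩ := exists_fresh_of_iterBlock_subset_Λ_compl F θ.ν θ.τ9.M (histA₁₃ θ K₀ g₀ K) (K₀ + K) (K₀ + K) s (lv K)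
      hmono hlv (hdvd_of_lv_le F θ.ν θ.τ9.M (histA₁₃ θ K₀ g₀ K) (lv K) hlvle) h1 hb
    exact ⟨⟨i, c⟩, Finset.mem_sigma.2 ⟨hi, Finset.mem_filter.2 ⟨Finset.mem_univ _, hcb⟩⟩, ⟨hcZ, hfresh⟩,
      fun b' hb' => hs b' (Finset.mem_insert_of_mem hb')⟩

open scoped Classical in
/-- ★★ **RUN B — THE NUMERATOR OF THE ONE-BLOCK LETTER IS COVERED BY THE FRESH-BLOCK EVENTS** (`0 < M`): the same over run B's sequences `s′` with the regions
`((truncShift … s′).Λ ·)ᶜ` of its key of record. [bookkeeping] -/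
theorem sum_insideInsert_le_sum_fresh_B (hM : 0 < θ.τ9.M) (K : ℕ) (t : ℝ) {j : ℕ} (h1 : 1 ≤ j)
    (hmono : ∀ i i', 1 ≤ i → i ≤ i' → i' ≤ j → lv K i ≤ lv K i') (hlv : ∀ i, lv K i ≤ F.m + (K₀ + K)) (hlvle : ∀ i, 1 ≤ i → i ≤ j → lv K i ≤ i)
    (S : Finset (Site (F.P (K₀ + K)) (lv K j))) (b : Site (F.P (K₀ + K)) (lv K j)) :
    ∑ s' ∈ Finset.univ.filter (fun s' : SeqOfRecord F θ.ν θ.τ9.M (histB₁₃ θ K₀ g₀ K) (K₀ + K + 1) (K₀ + K + 1) =>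
        ∀ b' ∈ insert b S, (↑(iterBlock (lv K j) b') : Set (Site (F.P (K₀ + K)) 0)) ⊆ ((truncShift F θ.ν hM (histB₁₃ θ K₀ g₀ K) s').Λ j)ᶜ),
      classWeightOfDatum₉ F N θ.toStage9Params (datumOfRecord₁₃CoPH F N θ hP) g₀ os (runB₁₃ F K₀ g₀ K) (histB₁₃ θ K₀ g₀ K) (K₀ + K + 1) t s' ≤
    ∑ i ∈ Finset.Icc 1 j, ∑ c ∈ Finset.univ.filter (fun c : Site (F.P (K₀ + K)) (lv K i) =>
        (↑(iterBlock (lv K i) c) : Set (Site (F.P (K₀ + K)) 0)) ⊆ ↑(iterBlock (lv K j) b)),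
      ∑ s' ∈ Finset.univ.filter (fun s' : SeqOfRecord F θ.ν θ.τ9.M (histB₁₃ θ K₀ g₀ K) (K₀ + K + 1) (K₀ + K + 1) =>
          ((↑(iterBlock (lv K i) c) : Set (Site (F.P (K₀ + K)) 0)) ⊆ ((truncShift F θ.ν hM (histB₁₃ θ K₀ g₀ K) s').Λ i)ᶜ ∧
            (2 ≤ i → (↑(iterBlock (lv K i) c) : Set (Site (F.P (K₀ + K)) 0)) ⊆ (truncShift F θ.ν hM (histB₁₃ θ K₀ g₀ K) s').Λ (i - 1))) ∧
          ∀ b' ∈ S, (↑(iterBlock (lv K j) b') : Set (Site (F.P (K₀ + K)) 0)) ⊆ ((truncShift F θ.ν hM (histB₁₃ θ K₀ g₀ K) s').Λ j)ᶜ),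
        classWeightOfDatum₉ F N θ.toStage9Params (datumOfRecord₁₃CoPH F N θ hP) g₀ os (runB₁₃ F K₀ g₀ K) (histB₁₃ θ K₀ g₀ K) (K₀ + K + 1) t s' := by
  have hw : ∀ s' : SeqOfRecord F θ.ν θ.τ9.M (histB₁₃ θ K₀ g₀ K) (K₀ + K + 1) (K₀ + K + 1),
      0 ≤ classWeightOfDatum₉ F N θ.toStage9Params (datumOfRecord₁₃CoPH F N θ hP) g₀ os (runB₁₃ F K₀ g₀ K) (histB₁₃ θ K₀ g₀ K) (K₀ + K + 1) t s' :=
    fun s' => classWeightOfDatum₉_nonneg' F N θ.toStage9Params (datumOfRecord₁₃CoPH F N θ hP) g₀ os (runB₁₃ F K₀ g₀ K) (histB₁₃ θ K₀ g₀ K) (K₀ + K + 1)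
      (wOfRecord₉_nonneg_of_provisos₁₃CoPH F θ hP (runB₁₃ F K₀ g₀ K) (histB₁₃ θ K₀ g₀ K)) t s'
  have h := sum_filter_le_sum_sum_filter_of_cover
    ((Finset.Icc 1 j).sigma fun i => Finset.univ.filter (fun c : Site (F.P (K₀ + K)) (lv K i) =>
      (↑(iterBlock (lv K i) c) : Set (Site (F.P (K₀ + K)) 0)) ⊆ ↑(iterBlock (lv K j) b)))
    (fun s' => classWeightOfDatum₉ F N θ.toStage9Params (datumOfRecord₁₃CoPH F N θ hP) g₀ os (runB₁₃ F K₀ g₀ K) (histB₁₃ θ K₀ g₀ K) (K₀ + K + 1) t s') hw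
    (fun s' : SeqOfRecord F θ.ν θ.τ9.M (histB₁₃ θ K₀ g₀ K) (K₀ + K + 1) (K₀ + K + 1) =>
      ∀ b' ∈ insert b S, (↑(iterBlock (lv K j) b') : Set (Site (F.P (K₀ + K)) 0)) ⊆ ((truncShift F θ.ν hM (histB₁₃ θ K₀ g₀ K) s').Λ j)ᶜ)
    (fun p s' => ((↑(iterBlock (lv K p.1) p.2) : Set (Site (F.P (K₀ + K)) 0)) ⊆ ((truncShift F θ.ν hM (histB₁₃ θ K₀ g₀ K) s').Λ p.1)ᶜ ∧
        (2 ≤ p.1 → (↑(iterBlock (lv K p.1) p.2) : Set (Site (F.P (K₀ + K)) 0)) ⊆ (truncShift F θ.ν hM (histB₁₃ θ K₀ g₀ K) s').Λ (p.1 - 1))) ∧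
      ∀ b' ∈ S, (↑(iterBlock (lv K j) b') : Set (Site (F.P (K₀ + K)) 0)) ⊆ ((truncShift F θ.ν hM (histB₁₃ θ K₀ g₀ K) s').Λ j)ᶜ) ?_
  · rw [Finset.sum_sigma] at h
    exact h
  · intro s' hs
    have hb : (↑(iterBlock (lv K j) b) : Set (Site (F.P (K₀ + K)) 0)) ⊆ ((truncShift F θ.ν hM (histB₁₃ θ K₀ g₀ K) s').Λ j)ᶜ :=
      hs b (Finset.mem_insert_self b S)
    obtain ⟨i, hi, c, hcb, hcZ, hfresh⟩ := exists_fresh_of_iterBlock_subset_Λ_compl F θ.ν θ.τ9.M (fun j => histB₁₃ θ K₀ g₀ K (j + 1)) (K₀ + K) (K₀ + K)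
      (truncShift F θ.ν hM (histB₁₃ θ K₀ g₀ K) s') (lv K) hmono hlv
      (hdvd_of_lv_le F θ.ν θ.τ9.M (fun j => histB₁₃ θ K₀ g₀ K (j + 1)) (lv K) hlvle) h1 hb
    exact ⟨⟨i, c⟩, Finset.mem_sigma.2 ⟨hi, Finset.mem_filter.2 ⟨Finset.mem_univ _, hcb⟩⟩, ⟨hcZ, hfresh⟩,
      fun b' hb' => hs b' (Finset.mem_insert_of_mem hb')⟩

variable (jcut : ℕ → ℕ) (ϱ k : ℕ → ℕ → ℕ)

open scoped Classical in
/-- The inheritance volume at one pair of levels: `b`'s level-`lv K j` block holds `(L^4)^{lv K j − lv K i}` level-`lv K i` blocks (NODE 00 `card_filter_iterBlock_subset` at `d = 4`).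
[bookkeeping] -/
theorem card_filter_iterBlock_subset_four (K : ℕ) {i j : ℕ} (hij : lv K i ≤ lv K j) (hlvj : lv K j ≤ F.m + (K₀ + K)) (b : Site (F.P (K₀ + K)) (lv K j)) :
    (Finset.univ.filter (fun c : Site (F.P (K₀ + K)) (lv K i) =>
        (↑(iterBlock (lv K i) c) : Set (Site (F.P (K₀ + K)) 0)) ⊆ ↑(iterBlock (lv K j) b))).card = (F.L ^ 4) ^ (lv K j - lv K i) := by
  have h := card_filter_iterBlock_subset (P := F.P (K₀ + K)) hij hlvj b
  rw [T4Family.P_L, T4Family.P_d] at h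
  exact h

open scoped Classical in
/-- ★★★ **THE N20 FACE AT THE RECORD's CARRIERS FROM FRESH-BLOCK CONDITIONAL LETTERS ON THE SEQUENCE INDEX OF RECORD** (`0 < M`; block levels `lv K` monotone on `[1, jcut K]` with
`lv K j ≤ j`; metric separation `SupNear (ϱ K j)`; schedule `k K j ≥ ⌈log₂ |Site_{lv K j}|⌉ + K + j + 3`; gen 34's numerics `0 ≤ η K j ≤ η₀ ≤ 1`,
`2·((2ϱ+1)^4·81·(2ϱ+1)^4)²·η K j ≤ 1`; and the INHERITANCE VOLUME `Σ_{i ∈ [1,j]} (L^4)^{lv K j − lv K i} · ζ K j i ≤ η K j`).  Run A's letter: for every step `K`, source `|t| ≤ 1`,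
level `j ∈ [1, jcut K]`, environment `S` of level-`lv K j` blocks, block `b ∉ S` farther than `ϱ K j` from `S`, level `i ∈ [1, j]` and level-`lv K i` block `c` inside `b`'s block, the
(2.18) class weights of run A's sequences of record with «`c ⊆ Z_i(s)`, `c ⊆ Λ_{i−1}(s)` (if `i ≥ 2`), blocks of `S ⊆ Z_j(s)`» sum to at most `ζ K j i` times those with «blocks of
`S ⊆ Z_j(s)`»; run B likewise over its sequences `s′` with the regions of `truncShift … s′`.  Conclusion: gen 34's face verbatim — `RelWeightBound` at
`crOfRecord₁₃K (keyReadingId₁₃ …) (badKeyReadingOfBigComponent₁₃ … (bigDialOfCard₁₃ K₀ ((2ϱ+1)^4·k·L^{4lv}))) …`'s carriers with `W K := η₀ · 2^{−(K+1)}`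
(via `…SeqIndex.relWeightBound_card_of_condInsideSeqLetters_id_supNear`, §3's cover and the volume count). [bookkeeping] -/
theorem relWeightBound_card_of_freshCondSeqLetters_id_supNear (hM : 0 < θ.τ9.M)
    {η : ℕ → ℕ → ℝ} {η₀ : ℝ} (hη0 : ∀ K j, 0 ≤ η K j) (hη1 : ∀ K j, η K j ≤ η₀) (hη₀ : η₀ ≤ 1)
    (hD : ∀ K j, 2 * ((((2 * ϱ K j + 1) ^ 4 : ℕ) : ℝ) * 3 ^ 4 * ((2 * ϱ K j + 1) ^ 4 : ℕ)) ^ 2 * η K j ≤ 1)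
    (hks : ∀ K j, Nat.clog 2 (Fintype.card (Site (F.P (K₀ + K)) (lv K j))) + K + j + 3 ≤ k K j) (hlv : ∀ K j, lv K j ≤ F.m + (K₀ + K))
    (hlvj : ∀ K, ∀ j ∈ Finset.Icc 1 (jcut K), lv K j ≤ j)
    (hmono : ∀ K i i', 1 ≤ i → i ≤ i' → i' ≤ jcut K → lv K i ≤ lv K i')
    {ζ : ℕ → ℕ → ℕ → ℝ} (hζη : ∀ K, ∀ j ∈ Finset.Icc 1 (jcut K), ∑ i ∈ Finset.Icc 1 j, ((F.L ^ 4) ^ (lv K j - lv K i) : ℝ) * ζ K j i ≤ η K j)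
    (hFA : ∀ (K : ℕ) (t : ℝ), |t| ≤ 1 → ∀ j ∈ Finset.Icc 1 (jcut K), ∀ (S : Finset (Site (F.P (K₀ + K)) (lv K j))) (b : Site (F.P (K₀ + K)) (lv K j)),
      b ∉ S → (∀ s ∈ S, ¬ SupNear (ϱ K j) b s) → ∀ i ∈ Finset.Icc 1 j, ∀ c : Site (F.P (K₀ + K)) (lv K i),
      (↑(iterBlock (lv K i) c) : Set (Site (F.P (K₀ + K)) 0)) ⊆ ↑(iterBlock (lv K j) b) →
      ∑ s ∈ Finset.univ.filter (fun s : SeqOfRecord F θ.ν θ.τ9.M (histA₁₃ θ K₀ g₀ K) (K₀ + K) (K₀ + K) =>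
          ((↑(iterBlock (lv K i) c) : Set (Site (F.P (K₀ + K)) 0)) ⊆ (s.Λ i)ᶜ ∧
            (2 ≤ i → (↑(iterBlock (lv K i) c) : Set (Site (F.P (K₀ + K)) 0)) ⊆ s.Λ (i - 1))) ∧
          ∀ b' ∈ S, (↑(iterBlock (lv K j) b') : Set (Site (F.P (K₀ + K)) 0)) ⊆ (s.Λ j)ᶜ),
        classWeightOfDatum₉ F N θ.toStage9Params (datumOfRecord₁₃CoPH F N θ hP) g₀ os (runA₁₃ F K₀ g₀ K) (histA₁₃ θ K₀ g₀ K) (K₀ + K) t s ≤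
      ζ K j i * ∑ s ∈ Finset.univ.filter (fun s : SeqOfRecord F θ.ν θ.τ9.M (histA₁₃ θ K₀ g₀ K) (K₀ + K) (K₀ + K) =>
          ∀ b' ∈ S, (↑(iterBlock (lv K j) b') : Set (Site (F.P (K₀ + K)) 0)) ⊆ (s.Λ j)ᶜ),
        classWeightOfDatum₉ F N θ.toStage9Params (datumOfRecord₁₃CoPH F N θ hP) g₀ os (runA₁₃ F K₀ g₀ K) (histA₁₃ θ K₀ g₀ K) (K₀ + K) t s)
    (hFB : ∀ (K : ℕ) (t : ℝ), |t| ≤ 1 → ∀ j ∈ Finset.Icc 1 (jcut K), ∀ (S : Finset (Site (F.P (K₀ + K)) (lv K j))) (b : Site (F.P (K₀ + K)) (lv K j)),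
      b ∉ S → (∀ s ∈ S, ¬ SupNear (ϱ K j) b s) → ∀ i ∈ Finset.Icc 1 j, ∀ c : Site (F.P (K₀ + K)) (lv K i),
      (↑(iterBlock (lv K i) c) : Set (Site (F.P (K₀ + K)) 0)) ⊆ ↑(iterBlock (lv K j) b) →
      ∑ s' ∈ Finset.univ.filter (fun s' : SeqOfRecord F θ.ν θ.τ9.M (histB₁₃ θ K₀ g₀ K) (K₀ + K + 1) (K₀ + K + 1) =>
          ((↑(iterBlock (lv K i) c) : Set (Site (F.P (K₀ + K)) 0)) ⊆ ((truncShift F θ.ν hM (histB₁₃ θ K₀ g₀ K) s').Λ i)ᶜ ∧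
            (2 ≤ i → (↑(iterBlock (lv K i) c) : Set (Site (F.P (K₀ + K)) 0)) ⊆ (truncShift F θ.ν hM (histB₁₃ θ K₀ g₀ K) s').Λ (i - 1))) ∧
          ∀ b' ∈ S, (↑(iterBlock (lv K j) b') : Set (Site (F.P (K₀ + K)) 0)) ⊆ ((truncShift F θ.ν hM (histB₁₃ θ K₀ g₀ K) s').Λ j)ᶜ),
        classWeightOfDatum₉ F N θ.toStage9Params (datumOfRecord₁₃CoPH F N θ hP) g₀ os (runB₁₃ F K₀ g₀ K) (histB₁₃ θ K₀ g₀ K) (K₀ + K + 1) t s' ≤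
      ζ K j i * ∑ s' ∈ Finset.univ.filter (fun s' : SeqOfRecord F θ.ν θ.τ9.M (histB₁₃ θ K₀ g₀ K) (K₀ + K + 1) (K₀ + K + 1) =>
          ∀ b' ∈ S, (↑(iterBlock (lv K j) b') : Set (Site (F.P (K₀ + K)) 0)) ⊆ ((truncShift F θ.ν hM (histB₁₃ θ K₀ g₀ K) s').Λ j)ᶜ),
        classWeightOfDatum₉ F N θ.toStage9Params (datumOfRecord₁₃CoPH F N θ hP) g₀ os (runB₁₃ F K₀ g₀ K) (histB₁₃ θ K₀ g₀ K) (K₀ + K + 1) t s') :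
    RelWeightBound 1 (classSetK₁₃ θ K₀ g₀ (keyReadingId₁₃ N K₀ F θ hP g₀ os)) (weightAK₁₃ θ hP K₀ g₀ os (keyReadingId₁₃ N K₀ F θ hP g₀ os))
      (weightBK₁₃ θ hP K₀ g₀ os (keyReadingId₁₃ N K₀ F θ hP g₀ os))
      (badClassK₁₃ θ K₀ g₀ (keyReadingId₁₃ N K₀ F θ hP g₀ os)
        (badKeyReadingOfBigComponent₁₃ N K₀ jcut (bigDialOfCard₁₃ K₀ (fun K j => (2 * ϱ K j + 1) ^ 4 * k K j * (F.L ^ 4) ^ lv K j)) F θ hP g₀ os))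
      (fun K => η₀ * (1 / 2) ^ (K + 1)) := by
  refine relWeightBound_card_of_condInsideSeqLetters_id_supNear θ hP K₀ g₀ os jcut ϱ k lv hM hη0 hη1 hη₀ hD hks hlv hlvj ?_ ?_
  · intro K t ht j hj S b hbS hfar
    obtain ⟨h1, hjc⟩ := Finset.mem_Icc.1 hj
    have hmono' : ∀ i i', 1 ≤ i → i ≤ i' → i' ≤ j → lv K i ≤ lv K i' := fun i i' hi hii' hi'j => hmono K i i' hi hii' (hi'j.trans hjc)
    have hlvle : ∀ i, 1 ≤ i → i ≤ j → lv K i ≤ i := fun i hi hij => hlvj K i (Finset.mem_Icc.2 ⟨hi, hij.trans hjc⟩)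
    -- nonnegativity of the environment sum
    have henv : 0 ≤ ∑ s ∈ Finset.univ.filter (fun s : SeqOfRecord F θ.ν θ.τ9.M (histA₁₃ θ K₀ g₀ K) (K₀ + K) (K₀ + K) =>
          ∀ b' ∈ S, (↑(iterBlock (lv K j) b') : Set (Site (F.P (K₀ + K)) 0)) ⊆ (s.Λ j)ᶜ),
        classWeightOfDatum₉ F N θ.toStage9Params (datumOfRecord₁₃CoPH F N θ hP) g₀ os (runA₁₃ F K₀ g₀ K) (histA₁₃ θ K₀ g₀ K) (K₀ + K) t s :=
      Finset.sum_nonneg fun s _ => classWeightOfDatum₉_nonneg' F N θ.toStage9Params (datumOfRecord₁₃CoPH F N θ hP) g₀ os (runA₁₃ F K₀ g₀ K)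
        (histA₁₃ θ K₀ g₀ K) (K₀ + K) (wOfRecord₉_nonneg_of_provisos₁₃CoPH F θ hP (runA₁₃ F K₀ g₀ K) (histA₁₃ θ K₀ g₀ K)) t s
    refine (sum_insideInsert_le_sum_fresh_A θ hP K₀ g₀ os lv K t h1 hmono' (hlv K) hlvle S b).trans ?_
    refine (Finset.sum_le_sum fun i hi => Finset.sum_le_sum fun c hc => hFA K t ht j hj S b hbS hfar i hi c (Finset.mem_filter.1 hc).2).trans ?_
    -- the volume count
    refine le_trans ?_ (mul_le_mul_of_nonneg_right (hζη K j hj) henv)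
    rw [Finset.sum_mul]
    refine Finset.sum_le_sum fun i hi => ?_
    obtain ⟨hi1, hij⟩ := Finset.mem_Icc.1 hi
    rw [Finset.sum_const, card_filter_iterBlock_subset_four K₀ lv K (hmono' i j hi1 hij le_rfl) (hlv K j) b, nsmul_eq_mul, mul_assoc]
    push_cast
    exact le_rfl
  · intro K t ht j hj S b hbS hfar
    obtain ⟨h1, hjc⟩ := Finset.mem_Icc.1 hj
    have hmono' : ∀ i i', 1 ≤ i → i ≤ i' → i' ≤ j → lv K i ≤ lv K i' := fun i i' hi hii' hi'j => hmono K i i' hi hii' (hi'j.trans hjc)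
    have hlvle : ∀ i, 1 ≤ i → i ≤ j → lv K i ≤ i := fun i hi hij => hlvj K i (Finset.mem_Icc.2 ⟨hi, hij.trans hjc⟩)
    have henv : 0 ≤ ∑ s' ∈ Finset.univ.filter (fun s' : SeqOfRecord F θ.ν θ.τ9.M (histB₁₃ θ K₀ g₀ K) (K₀ + K + 1) (K₀ + K + 1) =>
          ∀ b' ∈ S, (↑(iterBlock (lv K j) b') : Set (Site (F.P (K₀ + K)) 0)) ⊆ ((truncShift F θ.ν hM (histB₁₃ θ K₀ g₀ K) s').Λ j)ᶜ),
        classWeightOfDatum₉ F N θ.toStage9Params (datumOfRecord₁₃CoPH F N θ hP) g₀ os (runB₁₃ F K₀ g₀ K) (histB₁₃ θ K₀ g₀ K) (K₀ + K + 1) t s' :=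
      Finset.sum_nonneg fun s' _ => classWeightOfDatum₉_nonneg' F N θ.toStage9Params (datumOfRecord₁₃CoPH F N θ hP) g₀ os (runB₁₃ F K₀ g₀ K)
        (histB₁₃ θ K₀ g₀ K) (K₀ + K + 1) (wOfRecord₉_nonneg_of_provisos₁₃CoPH F θ hP (runB₁₃ F K₀ g₀ K) (histB₁₃ θ K₀ g₀ K)) t s'
    refine (sum_insideInsert_le_sum_fresh_B θ hP K₀ g₀ os lv hM K t h1 hmono' (hlv K) hlvle S b).trans ?_
    refine (Finset.sum_le_sum fun i hi => Finset.sum_le_sum fun c hc => hFB K t ht j hj S b hbS hfar i hi c (Finset.mem_filter.1 hc).2).trans ?_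
    refine le_trans ?_ (mul_le_mul_of_nonneg_right (hζη K j hj) henv)
    rw [Finset.sum_mul]
    refine Finset.sum_le_sum fun i hi => ?_
    obtain ⟨hi1, hij⟩ := Finset.mem_Icc.1 hi
    rw [Finset.sum_const, card_filter_iterBlock_subset_four K₀ lv K (hmono' i j hi1 hij le_rfl) (hlv K j) b, nsmul_eq_mul, mul_assoc]
    push_cast
    exact le_rfl

end Fresh

end YMDAG.UVSplit

end
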